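/-
Copyright (c) 2026. All rights reserved.
Released under Apache 2.0 license as described in the file LICENSE.
-/
import Mathlib.Combinatorics.SimpleGraph.Paths
import Mathlib.Combinatorics.SimpleGraph.Walk.Operations
import Mathlib.Combinatorics.SimpleGraph.Walk.Maps

/-!
# ShortCyclePatterns — S3 of the succinct isolation series (O-L2-15)

FEW SHORT CYCLES AS A PATTERN FAMILY (Fenner–Gurjar–Thierauf 2016, Lemma 3.5 and its Claim, after
Teo–Koh).  Let `H` be a graph in which every cycle has length `> 2L`.  Then between any two vertices
there is AT MOST ONE path of length `≤ L` (two distinct such paths contain a cycle of length `≤ 2L`,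
`SimpleGraph.Walk.IsPath.exists_isCycle_length_le_add_of_ne`).  A cycle `c` of length `≤ 4L` is cut
at the vertices `c(0), c(L), c(2L), c(3L)` (`Walk.take` / `Walk.drop`) into four paths of length `≤ L`, each
of which is THE short path between its end points.  Hence for any edge labelling `δ` with values in an
additive commutative monoid the dart sum `walkSum δ c` lies in the family
`{sp(x,y) + sp(y,z) + sp(z,w) + sp(w,x) : (x,y,z,w) ∈ V⁴}` of cardinality `≤ |V|^4`, where `sp` is the
short-path sum (`shortPathSum`, `shortCycleFamily`, `exists_shortCycle_family`).

Role in the series.  With `δ` = the signed monomial-indicator labelling of a constant-free read-once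
matrix, `walkSum δ c` is the circulation pattern `π_c` of the cycle `c` of the relation graph; the
family has `≤ (2r)^4` members; S1 (`SuccinctCirculationHashing.exists_cktSize_circ_ne_zero`) supplies
ONE succinct weight with non-zero circulation against all of them, and S2
(`MinimumPerfectMatchingFace.face_orthogonal`) removes every such cycle from the union of the minimum
perfect matchings — one isolation round doubles the girth bound `2L ↦ 4L` (FGT16 §3.2).  §1 is the
small `walkSum` calculus the later stages use (additivity, functoriality, flow conservation, and the
one-edge reading of a trail, which bounds the entries of cycle patterns by `1`).

Currency: kernel-certified helper for the W4 isolation road (stage S3 of 4); closes no item; three data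
defs (`walkSum`, `shortPathSum`, `shortCycleFamily`), no `def … : Prop`, no facts, no doors.
-/

set_option linter.dupNamespace false

namespace Summit.ValiantsHypothesis.ValiantsHypothesis.Theorems.ShortCyclePatterns

open SimpleGraph

variable {V : Type*} {A B : Type*} [AddCommMonoid A] [AddCommMonoid B] {H : SimpleGraph V}

/-! ## §1 Dart sums along walks -/

/-- The sum of an edge labelling `δ` along the darts of a walk (`δ a b` for the dart `a → b`).
[folklore] -/
def walkSum (δ : V → V → A) {u v : V} (p : H.Walk u v) : A :=
  (p.darts.map fun d => δ d.fst d.snd).sum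

/-- [folklore] -/
@[simp] theorem walkSum_nil (δ : V → V → A) (u : V) : walkSum δ (Walk.nil : H.Walk u u) = 0 := by
  simp [walkSum]

/-- [folklore] -/
@[simp] theorem walkSum_cons (δ : V → V → A) {u v w : V} (h : H.Adj u v) (p : H.Walk v w) :
    walkSum δ (Walk.cons h p) = δ u v + walkSum δ p := by
  simp [walkSum]

/-- [folklore] -/
theorem walkSum_append (δ : V → V → A) {u v w : V} (p : H.Walk u v) (q : H.Walk v w) :
    walkSum δ (p.append q) = walkSum δ p + walkSum δ q := by
  induction p with
  | nil => simp
  | cons h p ih => rw [Walk.cons_append, walkSum_cons, walkSum_cons, ih, add_assoc]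

/-- [folklore] -/
@[simp] theorem walkSum_copy (δ : V → V → A) {u v u' v' : V} (p : H.Walk u v) (hu : u = u')
    (hv : v = v') : walkSum δ (p.copy hu hv) = walkSum δ p := by
  subst hu hv
  rfl

/-- For an antisymmetric labelling the reversed walk has the opposite sum. [folklore] -/
theorem walkSum_reverse {A' : Type*} [AddCommGroup A'] (δ : V → V → A')
    (hδ : ∀ a b, H.Adj a b → δ b a = -δ a b) {u v : V} (p : H.Walk u v) :
    walkSum δ p.reverse = -walkSum δ p := by
  induction p with
  | nil => simp
  | cons h p ih =>
    simp only [Walk.reverse_cons, walkSum_append, walkSum_cons, walkSum_nil, ih, hδ _ _ h]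
    rw [add_zero, neg_add_rev]

/-- `walkSum` only depends on the values of `δ` on adjacent pairs. [folklore] -/
theorem walkSum_congr {δ δ' : V → V → A} (hδ : ∀ a b, H.Adj a b → δ a b = δ' a b) {u v : V}
    (p : H.Walk u v) : walkSum δ p = walkSum δ' p := by
  induction p with
  | nil => simp
  | cons h p ih => simp only [walkSum_cons, ih, hδ _ _ h]

/-- Additive maps commute with `walkSum`. [folklore] -/
theorem map_walkSum (φ : A →+ B) (δ : V → V → A) {u v : V} (p : H.Walk u v) :
    φ (walkSum δ p) = walkSum (fun a b => φ (δ a b)) p := by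
  induction p with
  | nil => simp
  | cons h p ih => simp only [walkSum_cons, map_add, ih]

/-- `walkSum` along the image of a walk under a graph homomorphism. [folklore] -/
theorem walkSum_map {V' : Type*} {H' : SimpleGraph V'} (f : H →g H') (δ : V' → V' → A) {u v : V}
    (p : H.Walk u v) : walkSum δ (p.map f) = walkSum (fun a b => δ (f a) (f b)) p := by
  induction p with
  | nil => simp
  | cons h p ih => simp only [Walk.map_cons, walkSum_cons, ih]

/-- `walkSum` is unchanged when a walk is viewed in a supergraph. [folklore] -/
theorem walkSum_mapLe {H' : SimpleGraph V} (h : H ≤ H') (δ : V → V → A) {u v : V}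
    (p : H.Walk u v) : walkSum δ (p.mapLe h) = walkSum δ p :=
  walkSum_map (Hom.ofLE h) δ p

/-- Flow conservation: the net number of darts of a walk `u ⟶ v` leaving a vertex `x` is
`[u = x] - [v = x]`; in particular it is `0` for closed walks. [folklore] -/
theorem walkSum_flow [DecidableEq V] (x : V) {u v : V} (p : H.Walk u v) :
    walkSum (fun a b => (if a = x then (1 : ℤ) else 0) - (if b = x then 1 else 0)) p
      = (if u = x then (1 : ℤ) else 0) - (if v = x then 1 else 0) := by
  induction p with
  | nil => simp
  | cons h p ih =>
    rw [walkSum_cons, ih, sub_add_sub_cancel]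

/-- If an additive functional of `walkSum δ p` is non-zero, it is non-zero on some dart of `p`.
[folklore] -/
theorem exists_dart_of_map_walkSum_ne_zero (φ : A →+ B) (δ : V → V → A) {u v : V}
    {p : H.Walk u v} (h : φ (walkSum δ p) ≠ 0) : ∃ d ∈ p.darts, φ (δ d.fst d.snd) ≠ 0 := by
  by_contra! hall
  apply h
  rw [map_walkSum]
  unfold walkSum
  apply List.sum_eq_zero
  intro x hx
  rw [List.mem_map] at hx
  obtain ⟨d, hd, rfl⟩ := hx
  exact hall d hd

/-- Along a TRAIL, an additive functional that sees only the darts of one edge `e` evaluates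
`walkSum` to `0` if `e` is not traversed, and to its value on the unique dart of `p` on `e`
otherwise (so the circulation patterns of cycles of a read-once labelling have entries in `{-1,0,1}`).
[folklore] -/
theorem map_walkSum_of_isTrail (φ : A →+ B) (δ : V → V → A) {e : Sym2 V}
    (he : ∀ a b, H.Adj a b → φ (δ a b) ≠ 0 → s(a, b) = e) {u v : V} {p : H.Walk u v}
    (hp : p.IsTrail) :
    (e ∉ p.edges → φ (walkSum δ p) = 0) ∧
      ∀ d ∈ p.darts, d.edge = e → φ (walkSum δ p) = φ (δ d.fst d.snd) := by
  induction p with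
  | nil => simp
  | @cons a b c h p ih =>
    rw [Walk.isTrail_cons] at hp
    obtain ⟨ih₁, ih₂⟩ := ih hp.1
    have hab : s(a, b) ≠ e → φ (δ a b) = 0 := fun hne => by
      by_contra hz
      exact hne (he a b h hz)
    refine ⟨fun hn => ?_, fun d hd hde => ?_⟩
    · rw [Walk.edges_cons, List.mem_cons, not_or] at hn
      rw [walkSum_cons, map_add, hab (Ne.symm hn.1), ih₁ hn.2, add_zero]
    · rw [Walk.darts_cons, List.mem_cons] at hd
      rw [walkSum_cons, map_add]
      rcases hd with rfl | hd
      · have hbe : e ∉ p.edges := by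
          rw [← hde]
          exact hp.2
        show φ (δ a b) + φ (walkSum δ p) = φ (δ a b)
        rw [ih₁ hbe, add_zero]
      · have hpe : e ∈ p.edges := by
          rw [← hde]
          exact List.mem_map_of_mem hd
        have hne : s(a, b) ≠ e := fun h' => hp.2 (by rw [h']; exact hpe)
        rw [hab hne, zero_add, ih₂ d hd hde]

/-! ## §2 Short paths are unique when all cycles are long -/

/-- If every cycle of `H` has length `> L`, two paths with the same end points and total length
`≤ L` coincide (the `∀`-cycles form of
`Literature.Combinatorics.SimpleGraph.IrregularMoore.path_unique_of_lt_girth`, which is stated with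
`egirth`; restated here to keep this file's cone inside Mathlib). [cite: FennerGurjarThierauf2016, Lemma 3.5] -/
theorem eq_of_length_add_le {L : ℕ} (hg : ∀ (w : V) (c : H.Walk w w), c.IsCycle → L < c.length)
    {x y : V} {p q : H.Walk x y} (hp : p.IsPath) (hq : q.IsPath) (hl : p.length + q.length ≤ L) :
    p = q := by
  by_contra hne
  obtain ⟨w, -, -, c, hc, hcl⟩ := hp.exists_isCycle_length_le_add_of_ne hq hne
  have := hg w c hc
  omega

/-! ## §3 The short-cycle pattern family -/

open Classical in
/-- The `δ`-sum of SOME path of length `≤ L` from `x` to `y` (and `0` if there is none); under the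
girth hypothesis «every cycle is longer than `2L`» this is the `δ`-sum of EVERY such path
(`walkSum_eq_shortPathSum`). [cite: FennerGurjarThierauf2016, Lemma 3.5] -/
noncomputable def shortPathSum (H : SimpleGraph V) (δ : V → V → A) (L : ℕ) (x y : V) : A :=
  if h : ∃ p : H.Walk x y, p.IsPath ∧ p.length ≤ L then walkSum δ h.choose else 0

/-- Under the girth hypothesis every path of length `≤ L` has `δ`-sum `shortPathSum`. [cite: FennerGurjarThierauf2016, Lemma 3.5] -/
theorem walkSum_eq_shortPathSum {δ : V → V → A} {L : ℕ}
    (hg : ∀ (w : V) (c : H.Walk w w), c.IsCycle → 2 * L < c.length) {x y : V} {p : H.Walk x y}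
    (hp : p.IsPath) (hl : p.length ≤ L) : walkSum δ p = shortPathSum H δ L x y := by
  classical
  have hex : ∃ q : H.Walk x y, q.IsPath ∧ q.length ≤ L := ⟨p, hp, hl⟩
  unfold shortPathSum
  rw [dif_pos hex]
  obtain ⟨hq₁, hq₂⟩ := hex.choose_spec
  congr 1
  exact eq_of_length_add_le hg hp hq₁ (by omega)

/-- The family of all sums of four short-path sums around a quadruple of vertices.
[cite: FennerGurjarThierauf2016, Lemma 3.5] -/
noncomputable def shortCycleFamily [Fintype V] [DecidableEq A] (H : SimpleGraph V) (δ : V → V → A)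
    (L : ℕ) : Finset A :=
  Finset.univ.image fun q : V × V × V × V =>
    shortPathSum H δ L q.1 q.2.1 + (shortPathSum H δ L q.2.1 q.2.2.1 +
      (shortPathSum H δ L q.2.2.1 q.2.2.2 + shortPathSum H δ L q.2.2.2 q.1))

/-- The family has at most `|V|^4` members. [cite: FennerGurjarThierauf2016, Lemma 3.5] -/
theorem card_shortCycleFamily_le [Fintype V] [DecidableEq A] (H : SimpleGraph V) (δ : V → V → A)
    (L : ℕ) : (shortCycleFamily H δ L).card ≤ Fintype.card V ^ 4 := by
  have h4 : Fintype.card V ^ 4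
      = Fintype.card V * (Fintype.card V * (Fintype.card V * Fintype.card V)) := by
    rw [show (4 : ℕ) = 1 + 1 + 1 + 1 from rfl, pow_succ, pow_succ, pow_succ, pow_one, mul_assoc,
      mul_assoc]
  unfold shortCycleFamily
  refine Finset.card_image_le.trans (le_of_eq ?_)
  rw [Finset.card_univ, Fintype.card_prod, Fintype.card_prod, Fintype.card_prod, h4]

/-- If every cycle of `H` is longer than `2L`, the `δ`-sum of every cycle of length `≤ 4L` belongs to
the family (cut the cycle into four short paths at `c(0), c(L), c(2L), c(3L)` with `Walk.take`/`Walk.drop`).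
[cite: FennerGurjarThierauf2016, Lemma 3.5] -/
theorem walkSum_mem_shortCycleFamily [Fintype V] [DecidableEq A] {δ : V → V → A} {L : ℕ}
    (hg : ∀ (w : V) (c : H.Walk w w), c.IsCycle → 2 * L < c.length) {u : V} {c : H.Walk u u}
    (hc : c.IsCycle) (hl : c.length ≤ 4 * L) : walkSum δ c ∈ shortCycleFamily H δ L := by
  have h3 := hc.three_le_length
  have hcL := hg u c hc
  have hL : L ≠ 0 := by omega
  -- the cut `c = c.take L ++ c.drop L` and its path pieces
  have hc₁ : ((c.take L).append (c.drop L)).IsCycle := by rwa [Walk.append_take_drop_eq]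
  have hnt : ¬ (c.take L).Nil := by
    rw [Walk.nil_take_iff]
    exact not_or.2 ⟨hc.not_nil, hL⟩
  have hnd : ¬ (c.drop L).Nil := by
    rw [Walk.nil_drop_iff]
    omega
  have hA : (c.take L).IsPath := hc₁.isPath_of_append_left hnd
  have hR : (c.drop L).IsPath := hc₁.isPath_of_append_right hnt
  have hB : ((c.drop L).take L).IsPath := hR.take L
  have hR₂ : ((c.drop L).drop L).IsPath := hR.drop L
  have hC : (((c.drop L).drop L).take L).IsPath := hR₂.take L
  have hD : (((c.drop L).drop L).drop L).IsPath := hR₂.drop L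
  -- lengths of the four pieces
  have lA : (c.take L).length ≤ L := (Walk.take_length _ _).le.trans (min_le_left _ _)
  have lB : ((c.drop L).take L).length ≤ L := (Walk.take_length _ _).le.trans (min_le_left _ _)
  have lC : (((c.drop L).drop L).take L).length ≤ L :=
    (Walk.take_length _ _).le.trans (min_le_left _ _)
  have lD : (((c.drop L).drop L).drop L).length ≤ L := by
    rw [Walk.drop_length, Walk.drop_length, Walk.drop_length]
    omega
  -- the sum splits along the cut
  have e₁ : walkSum δ c = walkSum δ (c.take L) + walkSum δ (c.drop L) := by
    rw [← walkSum_append, Walk.append_take_drop_eq]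
  have e₂ : walkSum δ (c.drop L)
      = walkSum δ ((c.drop L).take L) + walkSum δ ((c.drop L).drop L) := by
    rw [← walkSum_append, Walk.append_take_drop_eq]
  have e₃ : walkSum δ ((c.drop L).drop L)
      = walkSum δ (((c.drop L).drop L).take L) + walkSum δ (((c.drop L).drop L).drop L) := by
    rw [← walkSum_append, Walk.append_take_drop_eq]
  rw [shortCycleFamily, Finset.mem_image]
  refine ⟨(u, c.getVert L, (c.drop L).getVert L, ((c.drop L).drop L).getVert L),
    Finset.mem_univ _, ?_⟩
  dsimp only
  rw [e₁, e₂, e₃, walkSum_eq_shortPathSum hg hA lA, walkSum_eq_shortPathSum hg hB lB,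
    walkSum_eq_shortPathSum hg hC lC, walkSum_eq_shortPathSum hg hD lD]

/-- HEADLINE (FGT16 Lemma 3.5 and its Claim, as a pattern family).  If every cycle of a finite graph
is longer than `2L`, the dart sums of all cycles of length `≤ 4L` (all base points, both
orientations) lie in a family of at most `|V|^4` values. [cite: FennerGurjarThierauf2016, Lemma 3.5] -/
theorem exists_shortCycle_family {V : Type*} [Fintype V] {A : Type*} [AddCommMonoid A]
    [DecidableEq A] (H : SimpleGraph V) (δ : V → V → A) {L : ℕ}
    (hg : ∀ (u : V) (c : H.Walk u u), c.IsCycle → 2 * L < c.length) :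
    ∃ S : Finset A, S.card ≤ Fintype.card V ^ 4 ∧
      ∀ (u : V) (c : H.Walk u u), c.IsCycle → c.length ≤ 4 * L → walkSum δ c ∈ S :=
  ⟨shortCycleFamily H δ L, card_shortCycleFamily_le H δ L,
    fun _ _ hc hl => walkSum_mem_shortCycleFamily hg hc hl⟩

/-- Every cycle of a finite graph has length `≤ |V|`, so `⌈log₂ |V|⌉` girth doublings remove all
cycles. [folklore] -/
theorem length_le_card_of_isCycle [Fintype V] {u : V} {c : H.Walk u u} (hc : c.IsCycle) :
    c.length ≤ Fintype.card V := by
  have h₁ := hc.isPath_tail.length_lt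
  have h₂ := Walk.length_tail_add_one hc.not_nil
  omega

end Summit.ValiantsHypothesis.ValiantsHypothesis.Theorems.ShortCyclePatterns
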